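import Mathlib
import HarnessLib
import Summits.HubbardSuperconductivity.HubbardSuperconductivity.Theorems.KLProgrammeKLRegimeEngineV8TwoLegGridMomentsTelescope
import Summits.HubbardSuperconductivity.HubbardSuperconductivity.Theorems.KLProgrammeKLRegimeEngineV8GridLiterals
import Summits.HubbardSuperconductivity.HubbardSuperconductivity.Theorems.KLProgrammeKLRegimeEngineV8GridLiteralsPkgG
import Summits.HubbardSuperconductivity.HubbardSuperconductivity.Theorems.KLProgrammeKLRegimeEngineV8DefsG14

/-!
# Route `KLProgramme` — crux K3 ENGINE (stmt-HubbardSuperconductivity-20437 `KLRegimeEngineV17F2`), row (b) `stub_engine_step_norms` (e78dfb33d2f7),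
# producer hypothesis `hexG` (the grid two-leg moments package): THE PACKAGE `∃ e, IsGridLitPkg R e ∧ TwoLegGridMomentsStepCT P R (klEngQ7 P R) klEngGeo14 …`
# FROM THE LANDED FRAME BASE AND ONE E1 FAMILY OF WEIGHTED TWO-LEG SLICE-INCREMENT MASSES — by type (cell gate-hubbard-kl, seat p3 g24)

WHY.  Row (b) closes BY NAME as `A24a1G14.stub_engine_step_norms_of_E1rows hE₁ hE4 hexI hexG` (p727075); `hE4`/`hexI` are reduced to E1 plain-line families by
`…EngineWtLinesFlowDeep`/`…IsoMomWitnessFlowDeep`.  `hexG` is the grid two-leg moments producer (…V8GridLiteralsPkg): for every raise `Q` of `klEngQ7 P R`, under the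
v2 doors and the package's own thresholds, at every `1 ≤ n ≤ n_β+1`, the C-atom `TwoLegGridFlowMomentsAtC L M Zt Zs₁ Zs₂ cc β U μ n` at the flow frame `K_n`.  Its
landed bricks: the scale-`0` base IN AN ADMISSIBLE FRAME with the `R`-keyed literals `klZt0/klZs20/klZs1Base/klGridU₀` (k3c2-p1 g8, …V8GridLiterals:
`twoLegGrid_time_row_scaleZero_klZt0`, `twoLegGrid_space_row_scaleZero_klZs`) and the telescope over the slices in the plain currency
(`twoLegGridMomentsAt_of_wtIncrements_of_sum_le`, …TwoLegGridMomentsTelescope).  This file assembles them: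

* §1 `TwoLegGridMomentsAt.toC_of_split` (plain atom with `Zs = Zs₁·ĉ/|U| + Zs₂` ⇒ C-atom `(Zs₁, Zs₂)`), `twoLegGridMomentsAtC_scaleZero_klZ` (the base C-atom
  `(klZt0 R, klZs1Base R, klZs20 R)` at `(K, 0)` for `(Nsc+1)U² ≤ cc/log 4`), **`twoLegGridMomentsAtC_of_base_wtIncrements`** (base C-atom + `klScaleWt_{j+1}`-weighted
  plain-pin slice-increment masses `b j` (`j < n`) with `Σ_{j<n} Λ_{j+1}⁻¹·b j ≤ Bw` ⇒ C-atom `(Zt₀ + Bw, Zs₁, Zs₂ + 2Bw)` at `(K, n)`);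
* §2 **`exists_gridLitPkg_of_wtIncrements (hincr)`** ⊢ `∀ P R, P.WF → R.WF2 → ∃ e, IsGridLitPkg R e ∧ TwoLegGridMomentsStepCT P R (klEngQ7 P R) klEngGeo14 e.1 e.2.1 e.2.2`
  — EXACTLY the type of `hexG` in `…_of_E1rows` — from ONE E1 hypothesis family **`hincr`**: `∀ P R, P.WF → R.WF2 → ∃ Bw ≥ 0, ∃ uI > 0, ∃ cI > 0`, and under the
  producer's binders (raise `Q`, `0 < cc ≤ klEngC₃6 ⊓ cI`, `μ`, `0 < U ≤ klEngU₀10 ⊓ uI`, β-window, `klEngL₄/M₃`, `1 ≤ n ≤ n_β+1`, `HistP … klEngGeo14 … 0 n`,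
  `FrameOK … (K_n)`): `∃ b : ℕ → ℝ`, `Σ_{j<n} Λ_{j+1}⁻¹·b j ≤ Bw` and, for every `j < n` and pin `w`, the `klScaleWt_{j+1}`-weighted pinned sum of the two-leg kernel of
  the slice increment `W_{j+1}[K_n] − W_j[K_n]` of the grid effective action is `≤ b j·U²·β/(4M·2)` (the `hb` binder of `twoLegGridMomentsAt_of_wtIncrements`, verbatim).
  Package: `e = ((klZt0 R + Bw, klZs1Base R, klZs20 R + 2Bw), uI ⊓ klGridU₀ R, cI ⊓ 1)`; base literals `klZtBase0 ≤ klZt0`, `klZs2Base0 ≤ klZs20` (`klFrameA ≥ 16e⁸κ₀²`).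
So after this file ALL FOUR producer hypotheses of row (b) are, by type, consequences of named E1 / geometry hypothesis families.  Everything is proved; no definitions;
`hincr` has NO supplier in the tree (E1: the two-leg slice increments at the flow frame, BGM 2006 §3 (3.2)–(3.8)); nothing asserts it, `hexG`, row (b), any stub of
20437, K3 or superconductivity.  References: BGM 2006 §2.1 (2.4)–(2.5), §2.4 (2.36), §3 (3.2)–(3.8) [cite: BenfattoGiulianiMastropietro2006].
-/

noncomputable section

namespace Summit.HubbardSuperconductivity.HubbardSuperconductivity.Theorems.EngineV8

set_option linter.dupNamespace false -- summit = problem name (single-conjunct summit), D-0017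

open Classical
open Real Finset Literature.MathematicalPhysics.QuantumLattice Literature.Probability.LatticeModels
open Literature.Probability.LatticeModels.BattleFederbush GrassmannAlgebra
open Summit.HubbardSuperconductivity.HubbardSuperconductivity.Theorems.KLRegimeSplit
open Summit.HubbardSuperconductivity.HubbardSuperconductivity.Theorems.KLProgrammeLegKernels

section Atom

variable {L M : ℕ} [NeZero L] [NeZero M]

/-! ## §1 The base C-atom in a frame and the C-telescope -/

omit [NeZero M] in
/-- **Plain atom with a split space budget ⇒ C-atom**: `TwoLegGridMomentsAt … Zt (Zs₁·ĉ/|U| + Zs₂) … ⟹ TwoLegGridMomentsAtC … Zt Zs₁ Zs₂ c …` (`U ≠ 0`,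
`ĉ = c/log 4 + U²`). [folklore] -/
theorem TwoLegGridMomentsAt.toC_of_split {Zt Zs₁ Zs₂ c β U μ : ℝ} {K : TrigPolyC4v} {n : ℕ}
    (h : TwoLegGridMomentsAt L M Zt (Zs₁ * (c / Real.log 4 + U ^ 2) / |U| + Zs₂) β U μ K n) (hU : U ≠ 0) :
    TwoLegGridMomentsAtC L M Zt Zs₁ Zs₂ c β U μ K n :=
  ⟨h.1, fun σ p₀ => (h.2 σ p₀).trans (le_of_eq (by rw [mixedSpaceBudget_mul_sq hU]))⟩

/-- **The scale-0 base C-atom in an admissible frame**: `FrameOK R U Nsc μ K`, `R.WF`, `0 < U ≤ klGridU₀ R`, `|U| ≤ 1`, `(Nsc+1)U² ≤ c/log 4 ≤ 1`, `klBetaMin ≤ β`,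
`klEngL₃/M₃` ⇒ `TwoLegGridMomentsAtC L M (klZt0 R) (klZs1Base R) (klZs20 R) c β U μ K 0` (the base's `(Nsc+1)U²·|U|` share sits under `ĉ·|U|`).
[cite: BenfattoGiulianiMastropietro2006, §3 (3.2)-(3.8)] -/
theorem twoLegGridMomentsAtC_scaleZero_klZ {R : RenConsts} {μ U β c : ℝ} {Nsc : ℕ} {K : TrigPolyC4v} (hK : FrameOK R U Nsc μ K) (hR : R.WF) (hU : 0 < U)
    (hU₀ : U ≤ klGridU₀ R) (hU1 : |U| ≤ 1) (hN : ((Nsc : ℝ) + 1) * U ^ 2 ≤ c / Real.log 4) (hc1 : c / Real.log 4 ≤ 1) (hβ : klBetaMin ≤ β)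
    (hL : klEngL₃ β U ≤ L) (hM : klEngM₃ β U L ≤ M) :
    TwoLegGridMomentsAtC L M (klZt0 R) (klZs1Base R) (klZs20 R) c β U μ K 0 := by
  have hN1 : ((Nsc : ℝ) + 1) * U ^ 2 ≤ 1 := hN.trans hc1
  have hw : 0 ≤ β / (2 * ((2 * (2 * M) : ℕ) : ℝ)) := by
    have hβ0 : 0 < β := pos_of_klBetaMin_le hβ
    positivity
  refine ⟨fun σ p₀ => twoLegGrid_time_row_scaleZero_klZt0 hK hR hU hU₀ hU1 hN1 hβ hL hM σ p₀, fun σ p₀ => ?_⟩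
  simp only [pow_one]
  refine (twoLegGrid_space_row_scaleZero_klZs hK hR hU hU₀ hU1 hN1 hβ hL hM σ p₀).trans (mul_le_mul_of_nonneg_right ?_ hw)
  have h1 : klZs1Base R * (((Nsc : ℝ) + 1) * U ^ 2) * |U| ≤ klZs1Base R * (c / Real.log 4 + U ^ 2) * |U| :=
    mul_le_mul_of_nonneg_right (mul_le_mul_of_nonneg_left (by nlinarith [sq_nonneg U]) (klZs1Base_nonneg hR)) (abs_nonneg U)
  linarith

/-- **THE C-TELESCOPE**: the base C-atom `(Zt₀, Zs₁, Zs₂)` at `(K, 0)` and the `klScaleWt_{j+1}`-weighted plain-pin masses `b j` of the two-leg slice increments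
`W_{j+1}[K] − W_j[K]` (`j < n`) with `Σ_{j<n} Λ_{j+1}⁻¹·b j ≤ Bw` give the C-atom `(Zt₀ + Bw, Zs₁, Zs₂ + 2Bw)` at `(K, n)` (`0 ≤ β`, `U ≠ 0`).
[cite: BenfattoGiulianiMastropietro2006, §3 (3.2)-(3.8)] -/
theorem twoLegGridMomentsAtC_of_base_wtIncrements {Zt₀ Zs₁ Zs₂ c β U μ Bw : ℝ} {K : TrigPolyC4v} {n : ℕ} (b : ℕ → ℝ) (hβ : 0 ≤ β) (hU : U ≠ 0)
    (h0 : TwoLegGridMomentsAtC L M Zt₀ Zs₁ Zs₂ c β U μ K 0)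
    (hb : ∀ j < n, ∀ w : GridLeg (GridPoint L (2 * (2 * M))),
      ∑ Y ∈ univ.filter (fun Y : Fin 2 → GridLeg (GridPoint L (2 * (2 * M))) => Y 0 = w),
        klScaleWt L M β (j + 1) ((univ.image Y).image gridLegPos) *
          ‖kernel ℂ
            (effAction ℂ ((hubbardGridSub L M β (2 * (2 * M))).transpose *
                hubbardCovAboveCT L M β μ 0 K (klScale klE0 (j + 1)) * hubbardGridSub L M β (2 * (2 * M)))
              (hubbardGridInteraction L (2 * (2 * M)) β U + hubbardGridCounterQuadratic L (2 * (2 * M)) β K) -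
            effAction ℂ ((hubbardGridSub L M β (2 * (2 * M))).transpose *
                hubbardCovAboveCT L M β μ 0 K (klScale klE0 j) * hubbardGridSub L M β (2 * (2 * M)))
              (hubbardGridInteraction L (2 * (2 * M)) β U + hubbardGridCounterQuadratic L (2 * (2 * M)) β K)) 2 Y‖ ≤
        b j * U ^ 2 * (β / (2 * ((2 * (2 * M) : ℕ) : ℝ))))
    (hsum : ∑ j ∈ range n, (klScale klE0 (j + 1))⁻¹ * b j ≤ Bw) :
    TwoLegGridMomentsAtC L M (Zt₀ + Bw) Zs₁ (Zs₂ + 2 * Bw) c β U μ K n := by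
  have h := twoLegGridMomentsAt_of_wtIncrements_of_sum_le b hβ (h0.toMomentsAt hU) hb hsum
  refine TwoLegGridMomentsAt.toC_of_split (h.mono hβ le_rfl (le_of_eq ?_)) hU
  ring

end Atom

/-! ## §2 The `hexG` package from the E1 increment family -/

/-- `klZtBase0 R ≤ klZt0 R` and `klZs2Base0 R ≤ klZs20 R` (`klFrameA R ≥ 16e⁸κ₀²` under `R.WF`): the frame base literals dominate the package's n = 0 base rows. -/
theorem klZBase0_le_klZ0 {R : RenConsts} (hR : R.WF) : klZtBase0 R ≤ klZt0 R ∧ klZs2Base0 R ≤ klZs20 R := by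
  have hA : 16 * Real.exp 1 ^ 8 * Real.sqrt (2 * (7 + 1606732)) ^ 2 ≤ klFrameA R := by
    unfold klFrameA
    have := klFrameKR_nonneg hR
    nlinarith [pow_nonneg (Real.exp_pos 1).le 4]
  have hA0 : 0 ≤ 16 * Real.exp 1 ^ 8 * Real.sqrt (2 * (7 + 1606732)) ^ 2 := by positivity
  have hsq : (16 * Real.exp 1 ^ 8 * Real.sqrt (2 * (7 + 1606732)) ^ 2) ^ 2 ≤ klFrameA R ^ 2 := pow_le_pow_left₀ hA0 hA 2
  have he3 : 0 ≤ klE3A1 R := (klE3A1_pos R).le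
  constructor
  · calc klZtBase0 R = (4 * Real.exp 1 ^ 2 * klE3A1 R) * (16 * Real.exp 1 ^ 8 * Real.sqrt (2 * (7 + 1606732)) ^ 2) ^ 2 := by
          unfold klZtBase0; ring
      _ ≤ (4 * Real.exp 1 ^ 2 * klE3A1 R) * klFrameA R ^ 2 := mul_le_mul_of_nonneg_left hsq (by positivity)
      _ = klZt0 R := by unfold klZt0; ring
  · calc klZs2Base0 R = (8 * Real.exp 1 ^ 2 * klE3A1 R) * (16 * Real.exp 1 ^ 8 * Real.sqrt (2 * (7 + 1606732)) ^ 2) ^ 2 := by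
          unfold klZs2Base0; ring
      _ ≤ (8 * Real.exp 1 ^ 2 * klE3A1 R) * klFrameA R ^ 2 := mul_le_mul_of_nonneg_left hsq (by positivity)
      _ = klZs20 R := by unfold klZs20; ring

/-- **THE `hexG` PACKAGE OF ROW (b) FROM THE E1 INCREMENT FAMILY — BY TYPE** (see the module docstring for `hincr`): `∀ P R, P.WF → R.WF2 → ∃ e, IsGridLitPkg R e ∧
TwoLegGridMomentsStepCT P R (klEngQ7 P R) klEngGeo14 e.1 e.2.1 e.2.2` — the type of `hexG` in `A24a1G14.stub_engine_step_norms_of_E1rows`.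
[cite: BenfattoGiulianiMastropietro2006, §2.1 (2.4)-(2.5), §2.4 (2.36), §3 (3.2)-(3.8)] -/
theorem exists_gridLitPkg_of_wtIncrements
    (hincr : ∀ (P : SplitConsts) (R : RenConsts), P.WF → R.WF2 →
      ∃ Bw : ℝ, 0 ≤ Bw ∧ ∃ uI : EngConsts → ℝ → ℝ, (∀ Q cc, 0 < uI Q cc) ∧ ∃ cI : ℝ, 0 < cI ∧
      ∀ Q : EngConsts, (klEngQ7 P R).IsRaiseOf Q →
      ∀ cc : ℝ, 0 < cc → cc ≤ klEngC₃6 P R → cc ≤ cI →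
      ∀ μ ∈ klWindowC, ∀ U : ℝ, 0 < U → U ≤ klEngU₀10 P R cc → U ≤ uI Q cc →
      ∀ β : ℝ, klBetaMin ≤ β → β ≤ Real.exp (cc / U ^ 2) →
      ∀ (L M : ℕ) [NeZero L] [NeZero M], klEngL₄ P R β U ≤ L → klEngM₃ β U L ≤ M →
      ∀ n : ℕ, 1 ≤ n → n ≤ nScales β + 1 →
        HistP klPredsV17F2 L M klEngGeo14 P Q R β U μ 0 n → FrameOK R U (nScales β) μ (klFlowFrameU L M β U μ n) →
        ∃ b : ℕ → ℝ, (∑ j ∈ range n, (klScale klE0 (j + 1))⁻¹ * b j ≤ Bw) ∧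
          ∀ j < n, ∀ w : GridLeg (GridPoint L (2 * (2 * M))),
            ∑ Y ∈ univ.filter (fun Y : Fin 2 → GridLeg (GridPoint L (2 * (2 * M))) => Y 0 = w),
              klScaleWt L M β (j + 1) ((univ.image Y).image gridLegPos) *
                ‖kernel ℂ
                  (effAction ℂ ((hubbardGridSub L M β (2 * (2 * M))).transpose *
                      hubbardCovAboveCT L M β μ 0 (klFlowFrameU L M β U μ n) (klScale klE0 (j + 1)) * hubbardGridSub L M β (2 * (2 * M)))
                    (hubbardGridInteraction L (2 * (2 * M)) β U + hubbardGridCounterQuadratic L (2 * (2 * M)) β (klFlowFrameU L M β U μ n)) -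
                  effAction ℂ ((hubbardGridSub L M β (2 * (2 * M))).transpose *
                      hubbardCovAboveCT L M β μ 0 (klFlowFrameU L M β U μ n) (klScale klE0 j) * hubbardGridSub L M β (2 * (2 * M)))
                    (hubbardGridInteraction L (2 * (2 * M)) β U + hubbardGridCounterQuadratic L (2 * (2 * M)) β (klFlowFrameU L M β U μ n))) 2 Y‖ ≤
              b j * U ^ 2 * (β / (2 * ((2 * (2 * M) : ℕ) : ℝ)))) :
    ∀ (P : SplitConsts) (R : RenConsts), P.WF → R.WF2 →
      ∃ e : (ℝ × ℝ × ℝ) × (EngConsts → ℝ → ℝ) × ℝ, IsGridLitPkg R e ∧ TwoLegGridMomentsStepCT P R (klEngQ7 P R) klEngGeo14 e.1 e.2.1 e.2.2 := by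
  intro P R hP hR
  obtain ⟨Bw, hBw, uI, huI, cI, hcI, h⟩ := hincr P R hP hR
  have hRW : R.WF := hR.1
  obtain ⟨hZt, hZs⟩ := klZBase0_le_klZ0 hRW
  refine ⟨((klZt0 R + Bw, klZs1Base R, klZs20 R + 2 * Bw), fun Q cc => min (uI Q cc) (klGridU₀ R), min cI 1),
    ⟨by simp only; linarith, klZs1Base_nonneg hRW, by simp only; linarith, fun Q cc => lt_min (huI Q cc) (klGridU₀_pos hRW), lt_min hcI one_pos⟩, ?_⟩
  intro Q hQ cc hcc hcc6 hccG μ hμ U hU hU10 hUu β hβ hβc L M _ _ hL hM n hn1 hn hhist hfr _ _ _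
  have hccI : cc ≤ cI := hccG.trans (min_le_left _ _)
  have hcc1 : cc ≤ 1 := hccG.trans (min_le_right _ _)
  have hUI : U ≤ uI Q cc := hUu.trans (min_le_left _ _)
  have hUg : U ≤ klGridU₀ R := hUu.trans (min_le_right _ _)
  have hU1 : U ≤ 1 := le_one_of_le_klEngU₀3 (hU10.trans (klEngU₀10_le_klEngU₀3 P R cc))
  have hU1' : |U| ≤ 1 := by rwa [abs_of_pos hU]
  have hβ0 : 0 < β := pos_of_klBetaMin_le hβ
  have hlog : 1 ≤ Real.log 4 := by
    have := Real.add_one_le_exp (1 : ℝ)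
    rw [← Real.log_exp 1]
    exact Real.log_le_log (Real.exp_pos 1) (by linarith [Real.exp_one_lt_d9])
  have hc1 : cc / Real.log 4 ≤ 1 := by
    rw [div_le_one (by linarith)]
    exact hcc1.trans hlog
  have hN : (((nScales β : ℕ) : ℝ) + 1) * U ^ 2 ≤ cc / Real.log 4 := nScales_succ_mul_sq_le hcc.le hβ hβc
  have hL3 : klEngL₃ β U ≤ L := klEngL₃_le_of_klEngL₄_le hL
  obtain ⟨b, hbs, hb⟩ := h Q hQ cc hcc hcc6 hccI μ hμ U hU hU10 hUI β hβ hβc L M hL hM n hn1 hn hhist hfr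
  have h0 := twoLegGridMomentsAtC_scaleZero_klZ (L := L) (M := M) hfr hRW hU hUg hU1' hN hc1 hβ hL3 hM
  exact twoLegGridMomentsAtC_of_base_wtIncrements b hβ0.le hU.ne' h0 hb hbs

end Summit.HubbardSuperconductivity.HubbardSuperconductivity.Theorems.EngineV8

end
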